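import Summits.CriticalPhenomena.PercolationContinuityZ3.Theorems.PercNearOneGluingNoHeavyLowerTailForestRayleighTools
import HarnessLib

/-!
# Weighted forest negative correlation — relabelling: partition functions under an injective vertex map

Notation as in `…ForestRayleighTools`: `Z(D;K) = Σ_{G ⊆ D, ⟨G ∪ K⟩ acyclic} ∏_{g ∈ G} w g` for edge
systems in `Sym2 V`. For an injective vertex map `φ : U → V` and its edge map `Φ = Sym2.map φ`:

* `reachable_image_iff`: `φ a ~ φ b` in `⟨Φ X⟩` iff `a ~ b` in `⟨X⟩`;
* `isAcyclic_image_iff`: `⟨Φ X⟩` is acyclic iff `⟨X⟩` is (loop-free `X`);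
* `forestsW_image`: `Z_V(Φ D; Φ K)(w) = Z_U(D;K)(w ∘ Φ)`;
* `lsm_image`: the Rayleigh inequality `(R)(D;K;e,f)` transports from `U` (activities `w ∘ Φ`) to
  `(R)(Φ D; Φ K; Φ e, Φ f)` on `V`.

Used to move finite computations (e.g. on `Fin 4` for `K₄`) to arbitrary vertex types and to
exploit the symmetries of a pattern. Theorems only; no definitions, no `sorry`.
-/

open Finset SimpleGraph
open scoped Classical

namespace Summit.CriticalPhenomena.PercolationContinuityZ3.Theorems.ForestRayleigh

variable {U V : Type*} [Fintype U] [DecidableEq U] [Fintype V] [DecidableEq V]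

omit [Fintype U] [DecidableEq U] [Fintype V] in
/-- Membership in the image edge system. [elementary] -/
theorem mem_image_sym2Map_iff (φ : U → V) (X : Finset (Sym2 U)) (u v : V) :
    s(u, v) ∈ X.image (Sym2.map φ) ↔ ∃ a b, s(a, b) ∈ X ∧
      ((φ a = u ∧ φ b = v) ∨ (φ a = v ∧ φ b = u)) := by
  rw [Finset.mem_image]
  constructor
  · rintro ⟨z, hz, hzuv⟩
    revert hz hzuv
    refine Sym2.ind (fun a b => ?_) z
    intro hz hzuv
    rw [Sym2.map_mk, Sym2.eq_iff] at hzuv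
    exact ⟨a, b, hz, hzuv⟩
  · rintro ⟨a, b, hab, h⟩
    refine ⟨s(a, b), hab, ?_⟩
    rw [Sym2.map_mk, Sym2.eq_iff]
    exact h

omit [Fintype U] [DecidableEq U] [Fintype V] in
/-- The image of a loop-free edge system under a vertex map injective on it is loop-free.
[elementary] -/
theorem image_not_isDiag (φ : U → V) (hφ : Function.Injective φ) (X : Finset (Sym2 U))
    (hX : ∀ z ∈ X, ¬z.IsDiag) : ∀ z ∈ X.image (Sym2.map φ), ¬z.IsDiag := by
  intro z hz
  obtain ⟨y, hy, rfl⟩ := Finset.mem_image.1 hz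
  revert hy
  refine Sym2.ind (fun a b => ?_) y
  intro hy
  rw [Sym2.map_mk, Sym2.mk_isDiag_iff]
  exact fun h => hX _ hy (Sym2.mk_isDiag_iff.2 (hφ h))

omit [Fintype U] [DecidableEq U] [Fintype V] in
/-- Reachability is preserved by taking images. [elementary] -/
theorem reachable_image_of_reachable (φ : U → V) (hφ : Function.Injective φ) (X : Finset (Sym2 U))
    {a b : U} (h : (fromEdgeSet ((X : Finset (Sym2 U)) : Set (Sym2 U))).Reachable a b) :
    (fromEdgeSet ((X.image (Sym2.map φ) : Finset (Sym2 V)) : Set (Sym2 V))).Reachable (φ a) (φ b) := by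
  rw [SimpleGraph.reachable_iff_reflTransGen] at h
  induction h with
  | refl => exact Reachable.refl _
  | tail _ hcd ih =>
    rw [fromEdgeSet_adj, Finset.mem_coe] at hcd
    refine ih.trans (Adj.reachable ((fromEdgeSet_adj _).2 ⟨Finset.mem_coe.2 ?_, fun h => hcd.2 (hφ h)⟩))
    exact Finset.mem_image.2 ⟨_, hcd.1, Sym2.map_mk _ _ _⟩

omit [Fintype U] [DecidableEq U] [Fintype V] in
/-- **Reachability under an injective relabelling.** `φ a ~ φ b` in `⟨Φ X⟩` iff `a ~ b` in `⟨X⟩`.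
[elementary] -/
theorem reachable_image_iff (φ : U → V) (hφ : Function.Injective φ) (X : Finset (Sym2 U)) (a b : U) :
    (fromEdgeSet ((X.image (Sym2.map φ) : Finset (Sym2 V)) : Set (Sym2 V))).Reachable (φ a) (φ b) ↔
      (fromEdgeSet ((X : Finset (Sym2 U)) : Set (Sym2 U))).Reachable a b := by
  refine ⟨fun h => ?_, reachable_image_of_reachable φ hφ X⟩
  -- every vertex met from `φ a` is an image vertex, and the walk pulls back
  suffices key : ∀ y, (fromEdgeSet ((X.image (Sym2.map φ) : Finset (Sym2 V)) : Set (Sym2 V))).Reachable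
      (φ a) y → ∃ c, φ c = y ∧ (fromEdgeSet ((X : Finset (Sym2 U)) : Set (Sym2 U))).Reachable a c by
    obtain ⟨c, hc, hac⟩ := key _ h
    rw [hφ hc] at hac
    exact hac
  intro y hy
  rw [SimpleGraph.reachable_iff_reflTransGen] at hy
  induction hy with
  | refl => exact ⟨a, rfl, Reachable.refl _⟩
  | tail _ hyz ih =>
    rename_i y' z'
    obtain ⟨c, rfl, hac⟩ := ih
    rw [fromEdgeSet_adj, Finset.mem_coe, mem_image_sym2Map_iff] at hyz
    obtain ⟨⟨p, q, hpq, hcase⟩, hne⟩ := hyz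
    rcases hcase with ⟨hp, hq⟩ | ⟨hp, hq⟩
    · have hpc : p = c := hφ hp
      subst hpc
      refine ⟨q, hq, hac.trans (Adj.reachable ((fromEdgeSet_adj _).2 ⟨Finset.mem_coe.2 hpq, ?_⟩))⟩
      rintro rfl; exact hne hq
    · have hqc : q = c := hφ hq
      subst hqc
      refine ⟨p, hp, hac.trans (Adj.reachable ((fromEdgeSet_adj _).2 ⟨Finset.mem_coe.2 ?_, ?_⟩))⟩
      · rw [Sym2.eq_swap]; exact hpq
      · rintro rfl; exact hne hp

/-- **Acyclicity under an injective relabelling** (loop-free systems). [elementary] -/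
theorem isAcyclic_image_iff (φ : U → V) (hφ : Function.Injective φ) (X : Finset (Sym2 U))
    (hX : ∀ z ∈ X, ¬z.IsDiag) :
    (fromEdgeSet ((X.image (Sym2.map φ) : Finset (Sym2 V)) : Set (Sym2 V))).IsAcyclic ↔
      (fromEdgeSet ((X : Finset (Sym2 U)) : Set (Sym2 U))).IsAcyclic := by
  induction X using Finset.induction_on with
  | empty => simp only [Finset.image_empty, Finset.coe_empty, fromEdgeSet_empty, isAcyclic_bot]
  | insert g X hg ih =>
    have hX' : ∀ z ∈ X, ¬z.IsDiag := fun z hz => hX z (Finset.mem_insert_of_mem hz)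
    specialize ih hX'
    revert hg hX
    refine Sym2.ind (fun a b => ?_) g
    intro hg hX
    have hab : a ≠ b := fun h => hX _ (Finset.mem_insert_self _ _) (Sym2.mk_isDiag_iff.2 h)
    have hφab : φ a ≠ φ b := fun h => hab (hφ h)
    have hg' : s(φ a, φ b) ∉ X.image (Sym2.map φ) := by
      intro h
      obtain ⟨z, hz, hzab⟩ := Finset.mem_image.1 h
      have : z = s(a, b) := Sym2.map.injective hφ (by rw [hzab, Sym2.map_mk])
      exact hg (this ▸ hz)
    rw [Finset.image_insert, Sym2.map_mk,
      ForestExchange.isAcyclic_insert_iff (image_not_isDiag φ hφ X hX') hφab hg',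
      ForestExchange.isAcyclic_insert_iff hX' hab hg, ih, reachable_image_iff φ hφ X a b]

/-- **Partition functions under an injective relabelling.** `Z_V(Φ D; Φ K)(w) = Z_U(D;K)(w ∘ Φ)`
for loop-free `D ∪ K`. [elementary] -/
theorem forestsW_image (φ : U → V) (hφ : Function.Injective φ) (w : Sym2 V → ℝ)
    (D K : Finset (Sym2 U)) (hDK : ∀ z ∈ D ∪ K, ¬z.IsDiag) :
    ∑ G ∈ (D.image (Sym2.map φ)).powerset.filter (fun G =>
        (fromEdgeSet ((G ∪ K.image (Sym2.map φ) : Finset (Sym2 V)) : Set (Sym2 V))).IsAcyclic),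
        ∏ x ∈ G, w x =
      ∑ G ∈ D.powerset.filter (fun G =>
        (fromEdgeSet ((G ∪ K : Finset (Sym2 U)) : Set (Sym2 U))).IsAcyclic),
        ∏ x ∈ G, w (Sym2.map φ x) := by
  have hΦ : Function.Injective (Sym2.map φ) := Sym2.map.injective hφ
  symm
  refine Finset.sum_bij (fun G _ => G.image (Sym2.map φ)) ?_ ?_ ?_ ?_
  · intro G hG
    simp only [Finset.mem_filter, Finset.mem_powerset] at hG ⊢
    refine ⟨Finset.image_subset_image hG.1, ?_⟩
    rw [← Finset.image_union, isAcyclic_image_iff φ hφ _ (fun z hz => hDK z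
      (Finset.union_subset_union hG.1 (subset_refl K) hz))]
    exact hG.2
  · intro G₁ _ G₂ _ h
    exact Finset.image_injective hΦ h
  · intro G' hG'
    simp only [Finset.mem_filter, Finset.mem_powerset] at hG'
    obtain ⟨G, hGD, hGG'⟩ := Finset.subset_image_iff.1 hG'.1
    refine ⟨G, ?_, hGG'⟩
    simp only [Finset.mem_filter, Finset.mem_powerset]
    refine ⟨hGD, ?_⟩
    rw [← isAcyclic_image_iff φ hφ _ (fun z hz => hDK z
      (Finset.union_subset_union hGD (subset_refl K) hz)), Finset.image_union, hGG']
    exact hG'.2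
  · intro G _
    rw [Finset.prod_image (fun x _ y _ h => hΦ h)]

/-- **The Rayleigh inequality transports along an injective relabelling**: `(R)(D;K;e,f)` for the
activities `w ∘ Φ` on `U` gives `(R)(Φ D;Φ K;Φ e,Φ f)` for `w` on `V` (loop-free instance).
[elementary] -/
theorem lsm_image (φ : U → V) (hφ : Function.Injective φ) (w : Sym2 V → ℝ) (D K : Finset (Sym2 U))
    (e f : Sym2 U) (hDK : ∀ z ∈ D ∪ insert e (insert f K), ¬z.IsDiag)
    (h : (∑ G ∈ D.powerset.filter (fun G =>
        (fromEdgeSet ((G ∪ (insert e (insert f K)) : Finset (Sym2 U)) : Set (Sym2 U))).IsAcyclic),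
        ∏ x ∈ G, w (Sym2.map φ x)) *
      (∑ G ∈ D.powerset.filter (fun G =>
        (fromEdgeSet ((G ∪ K : Finset (Sym2 U)) : Set (Sym2 U))).IsAcyclic),
        ∏ x ∈ G, w (Sym2.map φ x)) ≤
      (∑ G ∈ D.powerset.filter (fun G =>
        (fromEdgeSet ((G ∪ (insert e K) : Finset (Sym2 U)) : Set (Sym2 U))).IsAcyclic),
        ∏ x ∈ G, w (Sym2.map φ x)) *
      (∑ G ∈ D.powerset.filter (fun G =>
        (fromEdgeSet ((G ∪ (insert f K) : Finset (Sym2 U)) : Set (Sym2 U))).IsAcyclic),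
        ∏ x ∈ G, w (Sym2.map φ x))) :
    (∑ G ∈ (D.image (Sym2.map φ)).powerset.filter (fun G =>
        (fromEdgeSet ((G ∪ (insert (Sym2.map φ e) (insert (Sym2.map φ f) (K.image (Sym2.map φ)))) :
          Finset (Sym2 V)) : Set (Sym2 V))).IsAcyclic), ∏ x ∈ G, w x) *
      (∑ G ∈ (D.image (Sym2.map φ)).powerset.filter (fun G =>
        (fromEdgeSet ((G ∪ K.image (Sym2.map φ) : Finset (Sym2 V)) : Set (Sym2 V))).IsAcyclic),
        ∏ x ∈ G, w x) ≤
    (∑ G ∈ (D.image (Sym2.map φ)).powerset.filter (fun G =>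
        (fromEdgeSet ((G ∪ (insert (Sym2.map φ e) (K.image (Sym2.map φ))) : Finset (Sym2 V)) :
          Set (Sym2 V))).IsAcyclic), ∏ x ∈ G, w x) *
      (∑ G ∈ (D.image (Sym2.map φ)).powerset.filter (fun G =>
        (fromEdgeSet ((G ∪ (insert (Sym2.map φ f) (K.image (Sym2.map φ))) : Finset (Sym2 V)) :
          Set (Sym2 V))).IsAcyclic), ∏ x ∈ G, w x) := by
  have hK : ∀ z ∈ D ∪ K, ¬z.IsDiag := fun z hz => hDK z (by
    rcases Finset.mem_union.1 hz with h | h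
    · exact Finset.mem_union_left _ h
    · exact Finset.mem_union_right _ (Finset.mem_insert_of_mem (Finset.mem_insert_of_mem h)))
  have hE : ∀ z ∈ D ∪ insert e K, ¬z.IsDiag := fun z hz => hDK z (by
    rcases Finset.mem_union.1 hz with h | h
    · exact Finset.mem_union_left _ h
    · rcases Finset.mem_insert.1 h with rfl | h
      · exact Finset.mem_union_right _ (Finset.mem_insert_self _ _)
      · exact Finset.mem_union_right _ (Finset.mem_insert_of_mem (Finset.mem_insert_of_mem h)))
  have hF : ∀ z ∈ D ∪ insert f K, ¬z.IsDiag := fun z hz => hDK z (by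
    rcases Finset.mem_union.1 hz with h | h
    · exact Finset.mem_union_left _ h
    · exact Finset.mem_union_right _ (Finset.mem_insert_of_mem h))
  have i₁ : insert (Sym2.map φ e) (insert (Sym2.map φ f) (K.image (Sym2.map φ))) =
      (insert e (insert f K)).image (Sym2.map φ) := by
    rw [Finset.image_insert, Finset.image_insert]
  have i₂ : insert (Sym2.map φ e) (K.image (Sym2.map φ)) = (insert e K).image (Sym2.map φ) := by
    rw [Finset.image_insert]
  have i₃ : insert (Sym2.map φ f) (K.image (Sym2.map φ)) = (insert f K).image (Sym2.map φ) := by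
    rw [Finset.image_insert]
  simp only [i₁]
  simp only [i₂, i₃]
  rw [forestsW_image φ hφ w D _ hDK, forestsW_image φ hφ w D K hK, forestsW_image φ hφ w D _ hE,
    forestsW_image φ hφ w D _ hF]
  exact h

end Summit.CriticalPhenomena.PercolationContinuityZ3.Theorems.ForestRayleigh
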